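import Literature.MathematicalPhysics.QuantumLattice.ReflectedCorrelationLogConvexity
import HarnessLib

/-!
# Stub `stub_rope` of line `Sketch` (crux `OSLegsAtWeakCouplingC`, stmt-QuantumFields-16207) — helper VI:
# real-variable asymptotics of the Hankel rope

Helper file for stub `stub_rope` (DefsR3 §4.4).  Pure real analysis behind the passage to the limit in the rope:
along the scheme the tree's Hankel bound (`norm_osCorr_timeShift_le_of_decay`) reads
`x_k ≤ (V_k^{N_k − 1} C_k)^{1/N_k} · e_k` with `x_k →` the connected OS form at separation `t`, `V_k →` the one at
separation `0`, `e_k → e^{−c₁ t}`, and the loss factor disappears (`tendsto_pow_pred_mul_rpow_inv`) as soon as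
`N_k → ∞` and `log C_k / N_k → 0`, which is what the growth demand `g (β_k) k ≤ L_k` of the soft bundle buys:
* `le_of_hankel_tendsto` — the limit inequality `x ≤ v · e`;
* `hankel_steps` — the number of dyadic steps `N = 2^J`, `J = log₂ ((L − w) / m)`: `2^J m + w ≤ L`, `L − w < 2 N m`;
* `tendsto_log_div_steps`, `tendsto_steps_atTop` — `log C_k / N_k → 0` and `N_k → ∞` from
  `a_k L_k ≥ (k+1)(k+1+Λ_k)`, `log C_k ≤ c + p Λ_k`, `a_k w_k ≤ T + 1`, `a_k m_k → t > 0`.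
-/

noncomputable section

open Filter Topology

namespace Summit.QuantumFields.YangMills.Theorems.OSLegsFromFemtoAndGap

/-- **The limit inequality of the rope.**  If eventually `x_k ≤ (V_k^{N_k−1} C_k)^{1/N_k} e_k` with `x_k → x`,
`0 ≤ V_k → v`, `0 < C_k`, `N_k → ∞`, `log C_k / N_k → 0`, `e_k → e`, then `x ≤ v · e`. -/
theorem le_of_hankel_tendsto {x V C e : ℕ → ℝ} {N : ℕ → ℕ} {x₀ v e₀ : ℝ}
    (hle : ∀ᶠ k in atTop, x k ≤ (V k ^ (N k - 1) * C k) ^ ((N k : ℝ)⁻¹) * e k)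
    (hx : Tendsto x atTop (𝓝 x₀)) (hV : ∀ k, 0 ≤ V k) (hVt : Tendsto V atTop (𝓝 v)) (hN : Tendsto N atTop atTop)
    (hC : ∀ k, 0 < C k) (hCt : Tendsto (fun k => Real.log (C k) / N k) atTop (𝓝 0))
    (he : Tendsto e atTop (𝓝 e₀)) : x₀ ≤ v * e₀ :=
  le_of_tendsto_of_tendsto hx
    ((Literature.MathematicalPhysics.QuantumLattice.tendsto_pow_pred_mul_rpow_inv hV hVt hN hC hCt).mul he) hle

/-- **The number of dyadic Hankel steps.**  For `1 ≤ m`, `m + w ≤ L` put `J := log₂ ((L − w) / m)`; then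
`2^J m + w ≤ L` (all dyadic shifts stay in the positive half) and `L − w < 2 · 2^J · m`. -/
theorem hankel_steps {L w m : ℕ} (hm : 1 ≤ m) (hmw : m + w ≤ L) :
    2 ^ Nat.log 2 ((L - w) / m) * m + w ≤ L ∧ L - w < 2 * 2 ^ Nat.log 2 ((L - w) / m) * m := by
  set Q := (L - w) / m with hQ
  have hQ1 : 1 ≤ Q := by
    rw [hQ, Nat.le_div_iff_mul_le (by omega)]; omega
  have h1 : 2 ^ Nat.log 2 Q ≤ Q := Nat.pow_log_le_self 2 (by omega)
  have h2 : Q < 2 ^ (Nat.log 2 Q + 1) := Nat.lt_pow_succ_log_self (by norm_num) Q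
  constructor
  · have : 2 ^ Nat.log 2 Q * m ≤ Q * m := Nat.mul_le_mul_right _ h1
    have hQm : Q * m ≤ L - w := by rw [hQ]; exact Nat.div_mul_le_self _ _
    omega
  · have hlt : L - w < (Q + 1) * m := by
      rw [hQ, Nat.succ_mul]; exact Nat.lt_div_mul_add (by omega)
    have h3 : (Q + 1) * m ≤ 2 ^ (Nat.log 2 Q + 1) * m := Nat.mul_le_mul_right _ h2
    calc L - w < (Q + 1) * m := hlt
      _ ≤ 2 ^ (Nat.log 2 Q + 1) * m := h3
      _ = 2 * 2 ^ Nat.log 2 Q * m := by rw [pow_succ]; ring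

/-- **The loss exponent vanishes under the growth demand.**  With `0 ≤ Λ_k`, `1 ≤ C_k`, `log C_k ≤ c + p Λ_k`,
`(k+1)(k+1+Λ_k) ≤ P_k` (physical torus side), `Q_k ≤ T + 1` (physical slab width), `u_k → t > 0` (physical
separation) and `P_k − Q_k < 2 N_k u_k` (the dyadic steps fill the torus), `log C_k / N_k → 0`. -/
theorem tendsto_log_div_steps' {u P Q Λ C : ℕ → ℝ} {N : ℕ → ℕ} {c p T t : ℝ} (hp : 0 ≤ p) (hc : 0 ≤ c)
    (hΛ : ∀ k, 0 ≤ Λ k) (hC1 : ∀ k, 1 ≤ C k) (hlogC : ∀ᶠ k in atTop, Real.log (C k) ≤ c + p * Λ k)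
    (hP : ∀ᶠ k : ℕ in atTop, ((k : ℝ) + 1) * ((k : ℝ) + 1 + Λ k) ≤ P k) (hQ : ∀ᶠ k in atTop, Q k ≤ T + 1)
    (hu : Tendsto u atTop (𝓝 t)) (ht : 0 < t) (hN : ∀ᶠ k in atTop, P k - Q k < 2 * N k * u k) :
    Tendsto (fun k => Real.log (C k) / N k) atTop (𝓝 0) := by
  -- eventually `u_k ≤ t + 1` and `(k+1)² ≥ 2 (T + 1)`, so `N_k ≥ (k+1)(k+1+Λ_k) / (4 (t+1))`
  have hu1 : ∀ᶠ k in atTop, u k ≤ t + 1 := hu.eventually (eventually_le_nhds (by linarith))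
  have hk2 : ∀ᶠ k : ℕ in atTop, 2 * (|T| + 1) ≤ ((k : ℝ) + 1) * ((k : ℝ) + 1) := by
    obtain ⟨k₀, hk₀⟩ := tendsto_atTop_atTop.1 (tendsto_natCast_atTop_atTop (R := ℝ)) (2 * (|T| + 1))
    refine eventually_atTop.2 ⟨k₀, fun k hk => ?_⟩
    have h1 : 2 * (|T| + 1) ≤ (k : ℝ) := hk₀ k hk
    have hT : 0 ≤ |T| := abs_nonneg T
    nlinarith
  -- the bound `0 ≤ log C_k / N_k ≤ 4 (t+1) (c/(k+1)² + p/(k+1))`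
  have hbound : ∀ᶠ k : ℕ in atTop, Real.log (C k) / N k ≤
      4 * (t + 1) * (c / (((k : ℝ) + 1) * ((k : ℝ) + 1)) + p / ((k : ℝ) + 1)) := by
    filter_upwards [hlogC, hP, hQ, hu1, hN, hk2] with k hlogC hP hQ hu1 hN hk2
    have hk1 : (0 : ℝ) < (k : ℝ) + 1 := by positivity
    set A : ℝ := ((k : ℝ) + 1) * ((k : ℝ) + 1 + Λ k) with hA
    have hA0 : ((k : ℝ) + 1) * ((k : ℝ) + 1) ≤ A := by rw [hA]; have := hΛ k; nlinarith
    have hApos : 0 < A := lt_of_lt_of_le (by positivity) hA0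
    -- `N_k ≥ A / (4 (t + 1))`
    have hNlow : A / (4 * (t + 1)) ≤ N k := by
      have h1 : A - (T + 1) ≤ P k - Q k := by linarith
      have h2 : A / 2 ≤ A - (T + 1) := by
        have : T ≤ |T| := le_abs_self T
        nlinarith
      have h3 : A / 2 < 2 * N k * u k := by linarith
      have hN0 : (0 : ℝ) ≤ N k := Nat.cast_nonneg _
      have h4 : 2 * N k * u k ≤ 2 * N k * (t + 1) := by nlinarith
      rw [div_le_iff₀ (by positivity)]
      nlinarith
    have hNpos : (0 : ℝ) < N k := lt_of_lt_of_le (by positivity) hNlow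
    have hlog0 : 0 ≤ Real.log (C k) := Real.log_nonneg (hC1 k)
    calc Real.log (C k) / N k ≤ (c + p * Λ k) / N k := by gcongr
      _ ≤ (c + p * Λ k) / (A / (4 * (t + 1))) := by
          apply div_le_div_of_nonneg_left _ (by positivity) hNlow
          have := hΛ k; positivity
      _ = 4 * (t + 1) * ((c + p * Λ k) / A) := by field_simp
      _ ≤ 4 * (t + 1) * (c / (((k : ℝ) + 1) * ((k : ℝ) + 1)) + p / ((k : ℝ) + 1)) := by
          gcongr
          rw [add_div]
          gcongr ?_ + ?_
          · exact div_le_div_of_nonneg_left hc (by positivity) hA0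
          · rw [hA, div_le_div_iff₀ hApos hk1]
            have := hΛ k
            nlinarith
  have hlow : ∀ᶠ k : ℕ in atTop, 0 ≤ Real.log (C k) / N k :=
    Eventually.of_forall fun k => div_nonneg (Real.log_nonneg (hC1 k)) (Nat.cast_nonneg _)
  -- the majorant tends to zero
  have hk1 : Tendsto (fun k : ℕ => (k : ℝ) + 1) atTop atTop :=
    tendsto_atTop_add_const_right _ 1 tendsto_natCast_atTop_atTop
  have hmaj : Tendsto (fun k : ℕ => 4 * (t + 1) * (c / (((k : ℝ) + 1) * ((k : ℝ) + 1)) + p / ((k : ℝ) + 1)))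
      atTop (𝓝 0) := by
    have h1 : Tendsto (fun k : ℕ => c / (((k : ℝ) + 1) * ((k : ℝ) + 1))) atTop (𝓝 0) :=
      tendsto_const_nhds.div_atTop (hk1.atTop_mul_atTop₀ hk1)
    have h2 : Tendsto (fun k : ℕ => p / ((k : ℝ) + 1)) atTop (𝓝 0) := tendsto_const_nhds.div_atTop hk1
    simpa using (h1.add h2).const_mul (4 * (t + 1))
  exact tendsto_of_tendsto_of_tendsto_of_le_of_le' tendsto_const_nhds hmaj hlow hbound

/-- **The loss exponent vanishes under the growth demand** (registered form). -/
theorem tendsto_log_div_steps : ∀ {u P Q Λ C : ℕ → ℝ} {N : ℕ → ℕ} {c p T t : ℝ}, 0 ≤ p → 0 ≤ c → (∀ k, 0 ≤ Λ k) → (∀ k, 1 ≤ C k) → (∀ᶠ k in Filter.atTop, Real.log (C k) ≤ c + p * Λ k) → (∀ᶠ k : ℕ in Filter.atTop, ((k : ℝ) + 1) * ((k : ℝ) + 1 + Λ k) ≤ P k) → (∀ᶠ k in Filter.atTop, Q k ≤ T + 1) → Filter.Tendsto u Filter.atTop (nhds t) → 0 < t → (∀ᶠ k in Filter.atTop, P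 k - Q k < 2 * N k * u k) → Filter.Tendsto (fun k => Real.log (C k) / N k) Filter.atTop (nhds 0) :=
  fun hp hc hΛ hC1 hlogC hP hQ hu ht hN => tendsto_log_div_steps' hp hc hΛ hC1 hlogC hP hQ hu ht hN

/-- **The number of steps diverges** under the same bookkeeping. -/
theorem tendsto_steps_atTop {u P Q Λ : ℕ → ℝ} {N : ℕ → ℕ} {T t : ℝ} (hΛ : ∀ k, 0 ≤ Λ k)
    (hP : ∀ᶠ k : ℕ in atTop, ((k : ℝ) + 1) * ((k : ℝ) + 1 + Λ k) ≤ P k) (hQ : ∀ᶠ k in atTop, Q k ≤ T + 1)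
    (hu : Tendsto u atTop (𝓝 t)) (ht : 0 < t) (hN : ∀ᶠ k in atTop, P k - Q k < 2 * N k * u k) :
    Tendsto N atTop atTop := by
  have hu1 : ∀ᶠ k in atTop, u k ≤ t + 1 := hu.eventually (eventually_le_nhds (by linarith))
  -- `N_k ≥ ((k+1)² − (T+1)) / (2 (t + 1))`
  have hlow : ∀ᶠ k : ℕ in atTop, (((k : ℝ) + 1) * ((k : ℝ) + 1) - (T + 1)) / (2 * (t + 1)) ≤ (N k : ℝ) := by
    filter_upwards [hP, hQ, hu1, hN] with k hP hQ hu1 hN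
    have hN0 : (0 : ℝ) ≤ N k := Nat.cast_nonneg _
    have h4 : 2 * N k * u k ≤ 2 * N k * (t + 1) := by nlinarith
    have := hΛ k
    rw [div_le_iff₀ (by positivity)]
    nlinarith
  have hk1 : Tendsto (fun k : ℕ => (k : ℝ) + 1) atTop atTop :=
    tendsto_atTop_add_const_right _ 1 tendsto_natCast_atTop_atTop
  have hmin : Tendsto (fun k : ℕ => (((k : ℝ) + 1) * ((k : ℝ) + 1) - (T + 1)) / (2 * (t + 1))) atTop atTop :=
    (tendsto_atTop_add_const_right _ _ (hk1.atTop_mul_atTop₀ hk1)).atTop_div_const (by positivity)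
  exact tendsto_natCast_atTop_iff.1 (tendsto_atTop_mono' _ hlow hmin)

end Summit.QuantumFields.YangMills.Theorems.OSLegsFromFemtoAndGap

end
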